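import Literature.MathematicalPhysics.QuantumFieldTheory.OSSkeletonAnalyticity
import Literature.Analysis.Distribution.LogWeightSchwartzFamily
import HarnessLib

/-!
# The slot weights `logW b θ` are Schwartz functions of the gap variable

Topic `Literature/MathematicalPhysics/QuantumFieldTheory`; the link between the weights
`logW b θ u = e^{-b log²u} θ(log u)/u` of `OSSkeletonAnalyticity` (Osterwalder–Schrader II, Ch. V,
the Gaussian-windowed profiles of the logarithmic gap variables) and the analysis file
`LogWeightSchwartz`: for a Schwartz profile `θ`, and for the modulated Gaussians of the flat tube
theorem, `logW b θ` **is** (the underlying function of) a Schwartz function of `u ∈ ℝ`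
(`logW_eq_logWeightSchwartz`, `logW_gaussMod_eq_logWeightSchwartz`), hence continuous
(`continuous_logW_schwartz`), with all Schwartz seminorms of the modulated family polynomial in the
frequency (`seminorm_logW_gaussMod_le`) — the regularity of the joint weights needed for the
time-averaged clusters of Ch. VI.1 (`OSAveragedClusters`).

## References

* K. Osterwalder, R. Schrader, *Axioms for Euclidean Green's functions II*, Comm. Math. Phys.
  42 (1975) 281–305, Ch. V p. 292, Ch. VI.1. [OsterwalderSchraderCMP1975]
-/

noncomputable section

open scoped SchwartzMap

namespace Literature.MathematicalPhysics.QuantumFieldTheory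

open Literature.Analysis.Distribution

/-- The Gaussian-windowed profile `F(s) = e^{-bs²} θ(s)` of a slot profile. [folklore] -/
def windowedProfile (b : ℝ) (θ : ℝ → ℂ) (s : ℝ) : ℂ := Complex.exp (-(b : ℂ) * (s : ℂ) ^ 2) * θ s

/-- **The slot weight is the log-weight function of the windowed profile**:
`logW b θ = logWeightFun (windowedProfile b θ)`. [folklore] -/
theorem logW_eq_logWeightFun (b : ℝ) (θ : ℝ → ℂ) : logW b θ = logWeightFun (windowedProfile b θ) := by
  funext u
  simp only [logW, logWeightFun, windowedProfile]

/-- The windowed profile of a Schwartz profile is smooth. [folklore] -/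
theorem contDiff_windowedProfile (b : ℝ) (θ : 𝓢(ℝ, ℂ)) : ContDiff ℝ (⊤ : ℕ∞) (windowedProfile b θ) :=
  contDiff_gaussian_mul b (θ.smooth ⊤)

/-- The windowed profile of a Schwartz profile decays super-exponentially with all derivatives (`b > 0`). [folklore] -/
theorem superExpDecay_windowedProfile {b : ℝ} (hb : 0 < b) (θ : 𝓢(ℝ, ℂ)) : SuperExpDecay (windowedProfile b θ) :=
  superExpDecay_gaussian_mul hb (θ.smooth ⊤) (temperate_of_schwartz θ)

/-- **The slot weight of a Schwartz profile as a Schwartz function of the gap.** [cite: OsterwalderSchraderCMP1975, Ch. VI.1] -/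
def logWSchwartz {b : ℝ} (hb : 0 < b) (θ : 𝓢(ℝ, ℂ)) : 𝓢(ℝ, ℂ) :=
  logWeightSchwartz (windowedProfile b θ) (contDiff_windowedProfile b θ) (superExpDecay_windowedProfile hb θ)

/-- Its values are the slot weight. [folklore] -/
@[simp] theorem logWSchwartz_apply {b : ℝ} (hb : 0 < b) (θ : 𝓢(ℝ, ℂ)) (u : ℝ) : logWSchwartz hb θ u = logW b θ u := by
  rw [logWSchwartz, logWeightSchwartz_apply, logW_eq_logWeightFun]

/-- As functions: `logW b θ = ⇑(logWSchwartz hb θ)`. [folklore] -/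
theorem logW_eq_logWSchwartz {b : ℝ} (hb : 0 < b) (θ : 𝓢(ℝ, ℂ)) : logW b θ = ⇑(logWSchwartz hb θ) :=
  funext fun u => (logWSchwartz_apply hb θ u).symm

/-- **Continuity of the slot weight** of a Schwartz profile. [folklore] -/
theorem continuous_logW_schwartz {b : ℝ} (hb : 0 < b) (θ : 𝓢(ℝ, ℂ)) : Continuous (logW b θ) := by
  rw [logW_eq_logWSchwartz hb θ]; exact (logWSchwartz hb θ).continuous

/-! ### The modulated Gaussians -/

/-- The windowed profile of a modulated Gaussian is the modulated Gaussian profile with window `2b`: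
`e^{-bs²} (e^{-bs²} e^{-2πips}) = e^{-2bs²} e^{-2πips}`. [folklore] -/
theorem windowedProfile_gaussMod (b p : ℝ) :
    windowedProfile b (fun s : ℝ => Complex.exp (-(b : ℂ) * (s : ℂ) ^ 2) * Complex.exp (↑(-2 * Real.pi * s * p) * Complex.I)) =
      gaussModProfile (2 * b) p := by
  funext s
  simp only [windowedProfile, gaussModProfile]
  rw [← mul_assoc, ← Complex.exp_add]
  congr 2
  push_cast
  ring

/-- **The slot weights of the modulated Gaussians as Schwartz functions**, through the family
`gaussModProfile (2b)`. [folklore] -/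
theorem logW_gaussMod_eq_logWeightSchwartz {b : ℝ} (hb : 0 < b) (p : ℝ) :
    logW b (fun s : ℝ => Complex.exp (-(b : ℂ) * (s : ℂ) ^ 2) * Complex.exp (↑(-2 * Real.pi * s * p) * Complex.I)) =
      ⇑(logWeightSchwartz (gaussModProfile (2 * b) p) (contDiff_gaussModProfile (2 * b) p)
        ((superExpDecayFamily_gaussMod (by positivity : 0 < 2 * b)).superExpDecay p)) := by
  funext u
  rw [logWeightSchwartz_apply, logW_eq_logWeightFun, windowedProfile_gaussMod]

/-- **Seminorms of the modulated slot weights are polynomial in the frequency.** [folklore] -/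
theorem seminorm_logW_gaussMod_le {b : ℝ} (hb : 0 < b) (k n : ℕ) :
    ∃ (C : ℝ) (D : ℕ), 0 ≤ C ∧ ∀ p,
      SchwartzMap.seminorm ℝ k n (logWeightSchwartz (gaussModProfile (2 * b) p) (contDiff_gaussModProfile (2 * b) p)
        ((superExpDecayFamily_gaussMod (by positivity : 0 < 2 * b)).superExpDecay p)) ≤ C * (1 + |p|) ^ D :=
  seminorm_logWeightSchwartz_family_le (contDiff_gaussModProfile (2 * b))
    (superExpDecayFamily_gaussMod (by positivity : 0 < 2 * b)) k n

end Literature.MathematicalPhysics.QuantumFieldTheory
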